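import Literature.AlgebraicGeometry.Frobenioids.KummerConjugation
import HarnessLib

/-!
# Frobenioids II, Definition 2.1 (ii) / Remark 2.4.1: `H_A` acts trivially on `H¹(H_A, μ_N(A))`

Mochizuki, *The geometry of Frobenioids II*, Kyushu J. Math. **62** (2008) 401–460, §2: "Here, we
note that `H_A` acts trivially on the cohomology module `H¹(H_A, μ_N(A))`" (Def. 2.1 (ii), p. 16),
used again in Remark 2.4.1 (p. 22): "(Hᵢ)_{Aᵢ} acts trivially on `H¹((Hᵢ)_{Aᵢ}, μ_N(Aᵢ))`"
[cite: MochizukiFrdII2008, Rmk 2.4.1 p.22]. PROVED here for the action `Kummer.h1Act` of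
`KummerConjugation.lean` (conjugation on the group, `x ↦ γ⁻¹ x` on the coefficients) when `γ` lies
in the subgroup itself: the conjugated cocycle differs from the original one by the coboundary of
`f(γ⁻¹)` (the standard computation; Mathlib's `groupCohomology` does not yet provide it). Proof-only
companion; nothing of [FrdII] is restated.
-/

namespace Literature.AlgebraicGeometry.Frobenioids

namespace Kummer

open CategoryTheory groupCohomology

variable {Γ : Type} [Group Γ] [TopologicalSpace Γ] [DiscreteTopology Γ]
  (N : ℕ) (O : Type) [CommMonoid O] [MulDistribMulAction Γ O]

/-- **Inner automorphisms act trivially on `H¹`**: for `γ = k₀ ∈ K = H_A`, the action `h1Act` of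
`γ` on `H¹(H_A, μ_N(A))` is the identity ("`H_A` acts trivially on `H¹(H_A, μ_N(A))`", FrdII Def. 2.1
(ii) p. 16, Rmk. 2.4.1 p. 22). [cite: MochizukiFrdII2008, Rmk 2.4.1 p.22] -/
theorem h1Act_eq_id_of_mem (K : Subgroup Γ) (k₀ : K)
    (hK : ∀ k ∈ K, (k₀ : Γ) * k * (k₀ : Γ)⁻¹ ∈ K) :
    h1Act N O K (k₀ : Γ) hK = 𝟙 _ := by
  -- restate the coefficient morphism without the `let` produced by the type ascription
  have key : h1Act N O K (k₀ : Γ) hK =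
      groupCohomology.map (conjSubgroupHom (k₀ : Γ) K K hK : K →* K)
        (A := Rep.ofMulDistribMulAction K (Mu N O)) (B := Rep.ofMulDistribMulAction K (Mu N O))
        (Rep.ofHom ⟨Representation.ofMulDistribMulAction Γ (Mu N O) (k₀ : Γ)⁻¹, fun k => by
          apply LinearMap.ext
          intro (x : Additive (Mu N O))
          show Additive.ofMul ((k₀ : Γ)⁻¹ • Additive.toMul (Additive.ofMul
              (((k₀ : Γ) * ((k : K) : Γ) * (k₀ : Γ)⁻¹) • Additive.toMul x))) =
            Additive.ofMul (((k : K) : Γ) • Additive.toMul (Additive.ofMul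
              ((k₀ : Γ)⁻¹ • Additive.toMul x)))
          rw [toMul_ofMul, toMul_ofMul, inv_smul_conj_smul]⟩) 1 := rfl
  rw [key, ← cancel_epi (H1π (Rep.ofMulDistribMulAction K (Mu N O))), Category.comp_id,
    H1π_comp_map]
  apply ModuleCat.hom_ext
  apply LinearMap.ext
  intro f
  change H1π (Rep.ofMulDistribMulAction K (Mu N O)) (mapCocycles₁ _ _ f) =
    H1π (Rep.ofMulDistribMulAction K (Mu N O)) f
  rw [H1π_eq_iff]
  refine ⟨f k₀⁻¹, funext fun k => ?_⟩
  have hc := (mem_cocycles₁_iff (A := Rep.ofMulDistribMulAction K (Mu N O)) f).1 f.2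
  rw [d₀₁_hom_apply, Pi.sub_apply, coe_mapCocycles₁]
  change _ = (Rep.ofMulDistribMulAction K (Mu N O)).ρ k₀⁻¹ (f (k₀ * k * k₀⁻¹)) - f k
  have e2 : (Rep.ofMulDistribMulAction K (Mu N O)).ρ k₀⁻¹ (f k₀) = - f k₀⁻¹ := by
    simpa using cocycles₁_map_inv f k₀⁻¹
  rw [show k₀ * k * k₀⁻¹ = k₀ * (k * k₀⁻¹) from mul_assoc _ _ _, hc k₀, hc k, map_add,
    ← Module.End.mul_apply, ← map_mul, inv_mul_cancel, map_one, Module.End.one_apply, e2]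
  abel

end Kummer

end Literature.AlgebraicGeometry.Frobenioids
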